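import Literature.Analysis.FluidPDE.FluidComputer.ThresholdLevelTableV
import HarnessLib

/-!
# Kernel run of the level-table checker over the box `V`, chunks 20 … 23 (bp3 gen 13, layer 4: robustness variant V)

HONEST FRAMING: low prior, high value-of-information experiment on Tao's machine paradigm; NOT a
claim that NS blows up.

Four kernel evaluations (`decide +kernel`; no `native_decide`, no extra axioms) of `runSteps`
with the interval gate data `GIv` (`ε, σ, r` within relative `3·10⁻²`, `δ ∈ [0, δ₀]`),
25 steps each, from `Bv20` to `Bv24`.
-/

namespace Literature.Analysis.FluidPDE.FluidComputer

namespace ThresholdLevelTable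

set_option maxHeartbeats 10000000 in
set_option maxRecDepth 200000 in
/-- Chunk 20 of the box-`V` table run (steps 500 … 524). [folklore] -/
theorem runV20 : runSteps 60 12 3 GIv RbIt Bv20 chunk20 18218920983040980 = some Bv21 := by
  decide +kernel

set_option maxHeartbeats 10000000 in
set_option maxRecDepth 200000 in
/-- Chunk 21 of the box-`V` table run (steps 525 … 549). [folklore] -/
theorem runV21 : runSteps 60 12 3 GIv RbIt Bv21 chunk21 21683499329800700 = some Bv22 := by
  decide +kernel

set_option maxHeartbeats 10000000 in
set_option maxRecDepth 200000 in
/-- Chunk 22 of the box-`V` table run (steps 550 … 574). [folklore] -/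
theorem runV22 : runSteps 60 12 3 GIv RbIt Bv22 chunk22 25806914889368432 = some Bv23 := by
  decide +kernel

set_option maxHeartbeats 10000000 in
set_option maxRecDepth 200000 in
/-- Chunk 23 of the box-`V` table run (steps 575 … 599). [folklore] -/
theorem runV23 : runSteps 60 12 3 GIv RbIt Bv23 chunk23 30714454617193348 = some Bv24 := by
  decide +kernel

end ThresholdLevelTable

end Literature.Analysis.FluidPDE.FluidComputer
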